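import Literature.Analysis.Matrix.WeightedRowSumEigenvalueBound
import Literature.MathematicalPhysics.QuantumManyBody.EliashbergTcMonotonicity
import Mathlib.NumberTheory.ZetaValues
import Mathlib.Data.Nat.Dist

/-!
# A ceiling for the Eliashberg `T_c`: `k_B T_c ≤ ħ (λ⟨ω²⟩/12)^{1/2}` for every `μ* ≥ 0`

Companion to `EliashbergTcMonotonicity` (`μ*`), `EliashbergTcCouplingMonotonicity` (coupling
scale), `EliashbergTcFrequencyScaling` and `EliashbergPhononKernelPSD`. Those files certify the
CORNER RULES of the conventional-branch `T_c` bands (`pub/hubbard-eph`) in threshold form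
`T_c = sSup {T > 0 | 1 ≤ ρ(T)}`, `ρ(T)` the top eigenvalue of the symmetrised linearised
isotropic Eliashberg kernel, and several of them carry the hypothesis that this super-level set is
bounded above. Here that hypothesis is DISCHARGED, with an explicit constant: for every Eliashberg
function `α²F ≥ 0` (a finite family of Einstein peaks `(λ_i, ω_i)`, which is literally what a
tabulated DFPT/EPW spectrum is), every Coulomb pseudopotential `μ* ≥ 0`, every Matsubara cutoff
`N ≥ 1` and either mass-renormalisation convention, the top eigenvalue is `< 1` as soon as
`12 T² > A := Σ_i λ_i ω_i² = λ⟨ω²⟩` (units `k_B = ħ = 1`). Hence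
`T_c ≤ (λ⟨ω²⟩/12)^{1/2} = 0.2887 (λ⟨ω²⟩)^{1/2}`.

The kernel. On the non-negative fermionic Matsubara frequencies `ω_n = πT(2n+1)`, `n < N`, the
linearised imaginary-axis equations fold (even gap) to the eigenproblem of the real symmetric matrix
`K_{nm} = (Λ_{nm} − 2μ*_N)/(d_n d_m)^{1/2}`, `Λ_{nm} = λ(|n−m|) + λ(n+m+1)` (Toeplitz plus Hankel),
`d_n = ω_n Z_n/(πT) = 2n+1 + λ(0) + 2Σ_{k=1}^{n} λ(k)` (full-line `Z` sum; a solver that truncates the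
`Z` sum at the same cutoff has `d_n = 2n+1 + Σ_{m<N} λ(|n−m|) − Σ_{m<N} λ(n+m+1)` instead — both are
covered), with `λ(k) = λ(k; T) = Σ_i λ_i ω_i²/(ω_i² + (2πTk)²)`; `T < T_c` iff `λ_max(K) ≥ 1`
[cite: AllenDynes1975, Eqs. (9)–(12)]. In the tree's vocabulary `K = rankOneDownshift S₀ s μ`
(`EliashbergTcMonotonicity`) with `S₀ = (Λ_{nm}/(d_n d_m)^{1/2})`.

The argument (linear algebra only):
* `dotProduct_mulVec_le_of_weightedRowSum_le` — the Collatz–Wielandt / Schur test: for a real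
  symmetric matrix with non-negative entries and a positive weight vector `p` with `(S p)_n ≤ θ p_n`
  for all `n`, every Rayleigh quotient is `≤ θ` [cite: HornJohnson2013, Thm. 8.1.26 and Cor. 8.1.29];
  hence `λ_max(S₀) ≤ θ` (`eigenvalues₀_max_le_of_weightedRowSum_le`) and, the Coulomb term being a
  positive-semidefinite rank-one SUBTRACTION, `λ_max(K) ≤ θ` for every `μ ≥ 0`
  (`eigenvalues₀_max_rankOneDownshift_le_of_weightedRowSum_le`).
* With `p_n = d_n^{1/2}` the test reads `Σ_m Λ_{nm} ≤ θ d_n`: ROW DOMINANCE of the phonon matrix by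
  the mass-renormalisation weights. The static coupling `λ(0)` appears once in row `n` of `Λ` and once
  in `d_n` and CANCELS (the imaginary-axis counterpart of `δT_c/δα²F(ω) → 0` as `ω → 0`); what is left
  is `Σ_m Λ_{nm} − (λ(0) + 2Σ_{k≤n} λ(k)) ≤ 2 Σ_{k>n} λ(k) ≤ 2τ` against `2n+1 ≥ 1`, where
  `τ ≥ Σ_{k=1}^{M} λ(k)` for all `M` (`sum_phononRow_lt_weight`, `sum_phononRow_lt_weight_trunc`).
* `λ(k) ≤ A/(2πTk)²` and `Σ_{k≥1} k^{-2} = π²/6` [Mathlib `hasSum_zeta_two`] give `τ = A/(24T²)`,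
  so `2τ < 1` iff `12T² > A` (`sum_matsubaraCoupling_succ_le`).
* `eliashbergTopEigenvalue_lt_one` / `…_trunc` assemble the above at one temperature;
  `sSup_superlevel_le_of_lt_one` is the threshold form (`BddAbove` and `sSup ≤ T*`), and
  `eliashbergTc_le_sqrt` states the ceiling `T_c ≤ (A/12)^{1/2}` for any solver whose `ρ(T)` is the
  top eigenvalue of such a kernel at each `T`.

Context in print. The large-`λ` law `T_c → 0.1827 (λ⟨ω²⟩)^{1/2}` is [cite: AllenDynes1975, Eq. (26)];
the Allen–Dynes formula's `f₁` factor is built to reproduce it, so the ceiling is the Migdal–Eliashberg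
counterpart of the Allen–Dynes asymptote at `1.58 ×` the sharp constant — it is NOT sharp. A rigorous
upper bound of the same form was proved only recently, by a variational/Hilbert–Schmidt route, with the
weaker constant `≈ 2.034 × 0.1827 = 0.372` [cite: KiesslingAltshulerYuzbashyan2025II, Thm. 6 and
abstract]; the row test used here is elementary and sharper. The same row test with the two- or
three-level weights `p = d^{1/2} · (1, v₁, v₂, v₂, …)` gives `0.2015` resp. `0.188` (numerics of the
proof's constants only; not formalised here). What this does NOT give: monotonicity of `ρ` in `T`
(uniqueness of the crossing), which in print is proved only for `T ≥ ω_max/(2√2 π)`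
[cite: KiesslingAltshulerYuzbashyan2025II, Thm. 2]; anisotropic kernels (covered a fortiori for the
STANDARD isotropic equation only); the nonlinear equations.

## References
* [AllenDynes1975] P. B. Allen, R. C. Dynes, Phys. Rev. B 12 (1975) 905 — Eqs. (9)–(12) (kernel),
  Eq. (26) (large-`λ` asymptote `0.1827 (λ⟨ω²⟩)^{1/2}`).
* [KiesslingAltshulerYuzbashyan2025II] M. K.-H. Kiessling, B. L. Altshuler, E. A. Yuzbashyan, *Bounds
  on `T_c` in the Eliashberg theory of superconductivity. II: dispersive phonons*, J. Stat. Phys. 192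
  (2025), doi:10.1007/s10955-025-03468-z (= arXiv:2409.00532) — Thm. 2 (monotonicity for
  `T ≥ Ω̄/(2√2π)`), Thm. 6 (explicit upper bound, `C ≈ 2.034 C_∞`), `C_∞ = 0.18272…`.
* [HornJohnson2013] R. A. Horn, C. R. Johnson, *Matrix Analysis*, 2nd ed., CUP 2013 — Thm. 8.1.26,
  Cor. 8.1.29 (Collatz–Wielandt bounds), Thm. 4.2.2 (Rayleigh).
-/

noncomputable section

open scoped Matrix

namespace Literature.MathematicalPhysics.QuantumManyBody

open Finset _root_.Matrix Literature.Analysis.Matrix Real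

/-! ### The Coulomb term only lowers the bound -/

section Coulomb

variable {ι : Type*} [Fintype ι] [DecidableEq ι]

/-- **The Coulomb pseudopotential only lowers the bound**: for the linearised Eliashberg kernel
`K(μ) = S₀ − 2μ ssᵀ` (`rankOneDownshift`) with `μ ≥ 0`, a weighted row-sum bound `θ` for the phonon
part `S₀` bounds the top eigenvalue of `K(μ)` as well (`xᵀK(μ)x ≤ xᵀS₀x`).
[cite: HornJohnson2013, Cor. 8.1.29 with Cor. 4.3.12] -/
theorem eigenvalues₀_max_rankOneDownshift_le_of_weightedRowSum_le {S₀ : Matrix ι ι ℝ}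
    (hS₀ : S₀.IsHermitian) (h0 : ∀ n m, 0 ≤ S₀ n m) {p : ι → ℝ} (hp : ∀ n, 0 < p n) {θ : ℝ}
    (hrow : ∀ n, ∑ m, S₀ n m * p m ≤ θ * p n) (s : ι → ℝ) {μ : ℝ} (hμ : 0 ≤ μ)
    (hn : 1 ≤ Fintype.card ι) :
    (isHermitian_rankOneDownshift hS₀ s μ).eigenvalues₀ (Fin.castLE hn 0) ≤ θ := by
  obtain ⟨h, horth, -, hsum⟩ :=
    KyFan.exists_frame_sum_rayleigh_eq (isHermitian_rankOneDownshift hS₀ s μ) (k := 1) hn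
  have hunit : h 0 ⬝ᵥ h 0 = 1 := by simpa using horth 0 0
  have hval : h 0 ⬝ᵥ rankOneDownshift S₀ s μ *ᵥ h 0 =
      (isHermitian_rankOneDownshift hS₀ s μ).eigenvalues₀ (Fin.castLE hn 0) := by simpa using hsum
  rw [← hval]
  have h1 := dotProduct_rankOneDownshift_mulVec_antitone S₀ s hμ (h 0)
  have h2 : rankOneDownshift S₀ s 0 = S₀ := by simp [rankOneDownshift]
  rw [h2] at h1
  have h3 := dotProduct_mulVec_le_of_weightedRowSum_le hS₀ h0 hp hrow (h 0)
  rw [hunit, mul_one] at h3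
  exact h1.trans h3

end Coulomb

/-! ### Row dominance of the Toeplitz-plus-Hankel phonon matrix by the renormalisation weights -/

section Rows

/-- Comparison of sums along an injection into a set where the summand is non-negative. [folklore] -/
private theorem sum_comp_le_sum_of_injOn {s t : Finset ℕ} (e : ℕ → ℕ) (he : Set.InjOn e s)
    (hst : ∀ r ∈ s, e r ∈ t) (g : ℕ → ℝ) (hg : ∀ j ∈ t, 0 ≤ g j) :
    ∑ r ∈ s, g (e r) ≤ ∑ j ∈ t, g j := by
  classical
  calc ∑ r ∈ s, g (e r) = ∑ j ∈ s.image e, g j := (Finset.sum_image he).symm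
    _ ≤ ∑ j ∈ t, g j :=
        Finset.sum_le_sum_of_subset_of_nonneg (Finset.image_subset_iff.mpr hst) fun j hj _ => hg j hj

/-- **Hankel rows are tails.** `Σ_{m<N} λ(n+m+1) ≤ τ` whenever every partial sum `Σ_{k=1}^{M} λ(k)` is
`≤ τ` and `λ ≥ 0` (the summands are `λ(n+1), …, λ(n+N)`). [cite: AllenDynes1975, Eqs. (9)–(12)] -/
theorem sum_range_hankel_le {lam : ℕ → ℝ} (hlam : ∀ k, 0 ≤ lam k) {τ : ℝ}
    (hτ : ∀ M, ∑ k ∈ Finset.range M, lam (k + 1) ≤ τ) (n N : ℕ) :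
    ∑ m ∈ Finset.range N, lam (n + m + 1) ≤ τ := by
  have h := sum_comp_le_sum_of_injOn (s := Finset.range N) (t := Finset.range (n + N))
    (fun m => n + m) (fun a _ b _ hab => by simpa using hab)
    (fun r hr => by simp only [Finset.mem_range] at hr ⊢; omega) (fun j => lam (j + 1))
    (fun j _ => hlam _)
  exact h.trans (hτ _)

/-- **Toeplitz rows are a head plus a tail.** `Σ_{m<N} λ(|n−m|) ≤ Σ_{k≤n} λ(k) + τ` under the same
hypotheses (`m ≤ n` contributes `λ(n−m)`, injective into `{0, …, n}`; `m > n` contributes `λ(m−n)`,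
injective into `{1, …, N}`). [cite: AllenDynes1975, Eqs. (9)–(12)] -/
theorem sum_range_toeplitz_le {lam : ℕ → ℝ} (hlam : ∀ k, 0 ≤ lam k) {τ : ℝ}
    (hτ : ∀ M, ∑ k ∈ Finset.range M, lam (k + 1) ≤ τ) (n N : ℕ) :
    ∑ m ∈ Finset.range N, lam (Nat.dist n m) ≤ (∑ k ∈ Finset.range (n + 1), lam k) + τ := by
  classical
  rw [← Finset.sum_filter_add_sum_filter_not (Finset.range N) (fun m => m ≤ n)]
  refine add_le_add ?_ ?_
  · have h := sum_comp_le_sum_of_injOn (s := (Finset.range N).filter (fun m => m ≤ n))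
      (t := Finset.range (n + 1)) (fun m => n - m)
      (fun a ha b hb hab => by
        simp only [Finset.coe_filter, Finset.mem_range, Set.mem_setOf_eq] at ha hb
        have : n - a = n - b := hab
        omega)
      (fun r hr => by simp only [Finset.mem_filter, Finset.mem_range] at hr ⊢; omega)
      lam (fun j _ => hlam j)
    refine le_of_eq_of_le (Finset.sum_congr rfl fun m hm => ?_) h
    simp only [Finset.mem_filter] at hm
    rw [Nat.dist_eq_sub_of_le_right hm.2]
  · have h := sum_comp_le_sum_of_injOn (s := (Finset.range N).filter (fun m => ¬ m ≤ n))
      (t := Finset.range N) (fun m => m - n - 1)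
      (fun a ha b hb hab => by
        simp only [Finset.coe_filter, Finset.mem_range, Set.mem_setOf_eq] at ha hb
        have : a - n - 1 = b - n - 1 := hab
        omega)
      (fun r hr => by simp only [Finset.mem_filter, Finset.mem_range] at hr ⊢; omega)
      (fun j => lam (j + 1)) (fun j _ => hlam _)
    refine (le_of_eq_of_le (Finset.sum_congr rfl fun m hm => ?_) h).trans (hτ N)
    simp only [Finset.mem_filter, not_le] at hm
    rw [Nat.dist_eq_sub_of_le hm.2.le]
    congr 1
    omega

/-- **Row dominance, full-line `Z` convention** (`d_n ≥ 2n+1 + λ(0) + 2Σ_{k=1}^{n} λ(k)`, the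
analytic value of `ω_n Z_n/(πT)`, as in engines that evaluate the `Z` sum over all Matsubara
frequencies): if `2τ < 1` then `Σ_{m<N} (λ(|n−m|) + λ(n+m+1)) < d_n`. The static coupling `λ(0)`
cancels between the row and the weight. [cite: AllenDynes1975, Eqs. (9)–(12)] -/
theorem sum_phononRow_lt_weight {lam : ℕ → ℝ} (hlam : ∀ k, 0 ≤ lam k) {τ : ℝ}
    (hτ : ∀ M, ∑ k ∈ Finset.range M, lam (k + 1) ≤ τ) (h2τ : 2 * τ < 1) (n N : ℕ) {dn : ℝ}
    (hd : (2 * (n : ℝ) + 1) + lam 0 + 2 * ∑ k ∈ Finset.range n, lam (k + 1) ≤ dn) :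
    ∑ m ∈ Finset.range N, (lam (Nat.dist n m) + lam (n + m + 1)) < dn := by
  rw [Finset.sum_add_distrib]
  have hT := sum_range_toeplitz_le hlam hτ n N
  have hH := sum_range_hankel_le hlam hτ n N
  rw [Finset.sum_range_succ'] at hT
  have hhead : 0 ≤ ∑ k ∈ Finset.range n, lam (k + 1) := Finset.sum_nonneg fun k _ => hlam _
  have hn0 : (0 : ℝ) ≤ n := Nat.cast_nonneg n
  linarith

/-- **Row dominance, truncated `Z` convention** (`d_n ≥ 2n+1 + Σ_{m<N} λ(|n−m|) − Σ_{m<N} λ(n+m+1)`,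
the `Z` sum restricted to the same `N` frequencies): if `2τ < 1` then again
`Σ_{m<N} (λ(|n−m|) + λ(n+m+1)) < d_n` — here the cancellation is exact and only the Hankel tail
`2Σ_{m<N} λ(n+m+1) ≤ 2τ < 1 ≤ 2n+1` remains. [cite: AllenDynes1975, Eqs. (9)–(12)] -/
theorem sum_phononRow_lt_weight_trunc {lam : ℕ → ℝ} (hlam : ∀ k, 0 ≤ lam k) {τ : ℝ}
    (hτ : ∀ M, ∑ k ∈ Finset.range M, lam (k + 1) ≤ τ) (h2τ : 2 * τ < 1) (n N : ℕ) {dn : ℝ}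
    (hd : (2 * (n : ℝ) + 1) + ∑ m ∈ Finset.range N, lam (Nat.dist n m)
      - ∑ m ∈ Finset.range N, lam (n + m + 1) ≤ dn) :
    ∑ m ∈ Finset.range N, (lam (Nat.dist n m) + lam (n + m + 1)) < dn := by
  rw [Finset.sum_add_distrib]
  have hH := sum_range_hankel_le hlam hτ n N
  have hn0 : (0 : ℝ) ≤ n := Nat.cast_nonneg n
  linarith

end Rows

/-! ### The couplings at temperature `T`: `λ(k) ≤ A/(2πTk)²` and the `ζ(2)` tail -/

section Couplings

variable {κ : Type*}

/-- **The Matsubara couplings of a non-negative discrete spectrum are non-negative.**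
`λ(k; T) = Σ_i λ_i ω_i²/(ω_i² + (2πTk)²) ≥ 0`. [cite: AllenDynes1975, Eqs. (9)–(12)] -/
theorem matsubaraCouplingDiscrete_nonneg (s : Finset κ) {l : κ → ℝ} (ω : κ → ℝ)
    (hl : ∀ i ∈ s, 0 ≤ l i) (T : ℝ) (k : ℕ) :
    0 ≤ ∑ i ∈ s, l i * (ω i ^ 2 / (ω i ^ 2 + (2 * π * T * k) ^ 2)) :=
  Finset.sum_nonneg fun i hi => mul_nonneg (hl i hi) (div_nonneg (sq_nonneg _) (by positivity))

/-- **Each dynamic coupling is at most `A/(2πTk)²`** (`A = Σ_i λ_i ω_i² = λ⟨ω²⟩`): drop `ω_i²` from the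
denominator. [cite: AllenDynes1975, Eqs. (9)–(12)] -/
theorem matsubaraCouplingDiscrete_le (s : Finset κ) {l : κ → ℝ} (ω : κ → ℝ)
    (hl : ∀ i ∈ s, 0 ≤ l i) {T : ℝ} (hT : 0 < T) {k : ℕ} (hk : 1 ≤ k) :
    ∑ i ∈ s, l i * (ω i ^ 2 / (ω i ^ 2 + (2 * π * T * k) ^ 2)) ≤
      (∑ i ∈ s, l i * ω i ^ 2) / (2 * π * T * k) ^ 2 := by
  have hk' : (0 : ℝ) < k := by exact_mod_cast hk
  have hc : 0 < (2 * π * T * k) ^ 2 := by positivity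
  rw [Finset.sum_div]
  refine Finset.sum_le_sum fun i hi => ?_
  rw [mul_div_assoc]
  refine mul_le_mul_of_nonneg_left ?_ (hl i hi)
  exact div_le_div_of_nonneg_left (sq_nonneg _) hc (le_add_of_nonneg_left (sq_nonneg _))

/-- Partial sums of `1/k²` are below `π²/6` (non-negative series, Mathlib `hasSum_zeta_two`). [folklore] -/
private theorem sum_range_inv_succ_sq_le (M : ℕ) :
    ∑ k ∈ Finset.range M, 1 / ((k : ℝ) + 1) ^ 2 ≤ π ^ 2 / 6 := by
  have h := sum_le_hasSum (Finset.range (M + 1)) (fun n _ => by positivity) hasSum_zeta_two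
  rw [Finset.sum_range_succ'] at h
  simpa using h

/-- **The tail bound `τ = A/(24T²)`**: `Σ_{k=1}^{M} λ(k; T) ≤ (A/(2πT)²)(π²/6) = A/(24T²)` for every `M`.
[cite: AllenDynes1975, Eqs. (9)–(12)] -/
theorem sum_matsubaraCoupling_succ_le (s : Finset κ) {l : κ → ℝ} (ω : κ → ℝ)
    (hl : ∀ i ∈ s, 0 ≤ l i) {T : ℝ} (hT : 0 < T) (M : ℕ) :
    ∑ k ∈ Finset.range M, ∑ i ∈ s, l i * (ω i ^ 2 / (ω i ^ 2 + (2 * π * T * (k + 1 : ℕ)) ^ 2)) ≤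
      (∑ i ∈ s, l i * ω i ^ 2) / (24 * T ^ 2) := by
  set A := ∑ i ∈ s, l i * ω i ^ 2 with hA
  have hA0 : 0 ≤ A := Finset.sum_nonneg fun i hi => mul_nonneg (hl i hi) (sq_nonneg _)
  have hstep : ∀ k ∈ Finset.range M,
      ∑ i ∈ s, l i * (ω i ^ 2 / (ω i ^ 2 + (2 * π * T * (k + 1 : ℕ)) ^ 2)) ≤
        A / (2 * π * T) ^ 2 * (1 / ((k : ℝ) + 1) ^ 2) := fun k _ => by
    have h := matsubaraCouplingDiscrete_le s ω hl hT (k := k + 1) (by omega)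
    refine h.trans (le_of_eq ?_)
    push_cast
    field_simp
    exact hA.symm
  calc _ ≤ ∑ k ∈ Finset.range M, A / (2 * π * T) ^ 2 * (1 / ((k : ℝ) + 1) ^ 2) := Finset.sum_le_sum hstep
    _ = A / (2 * π * T) ^ 2 * ∑ k ∈ Finset.range M, 1 / ((k : ℝ) + 1) ^ 2 := by rw [Finset.mul_sum]
    _ ≤ A / (2 * π * T) ^ 2 * (π ^ 2 / 6) :=
        mul_le_mul_of_nonneg_left (sum_range_inv_succ_sq_le M) (by positivity)
    _ = A / (24 * T ^ 2) := by field_simp; ring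

end Couplings

/-! ### Assembly: the top eigenvalue is `< 1` above `(A/12)^{1/2}` -/

section Assembly

variable {κ : Type*} {N : ℕ}

/-- **Row dominance makes the kernel subcritical.** On `Fin N`: if `Λ_{nm} = λ(|n−m|) + λ(n+m+1)`
with `λ ≥ 0`, the weights satisfy `Σ_m Λ_{nm} < d_n`, `S₀ = (Λ_{nm}/(d_n d_m)^{1/2})` and `μ ≥ 0`,
then `λ_max(S₀ − 2μ ssᵀ) < 1` (weighted row test with `p = d^{1/2}`).
[cite: HornJohnson2013, Cor. 8.1.29] -/
theorem eigenvalues₀_max_lt_one_of_rowDominance (lam : ℕ → ℝ) (hlam : ∀ k, 0 ≤ lam k)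
    (Λ : Matrix (Fin N) (Fin N) ℝ)
    (hΛ : ∀ n m : Fin N, Λ n m = lam (Nat.dist n m) + lam ((n : ℕ) + m + 1))
    (d : Fin N → ℝ) (hdom : ∀ n : Fin N, ∑ m, Λ n m < d n)
    (S₀ : Matrix (Fin N) (Fin N) ℝ) (hS₀ : S₀.IsHermitian)
    (hS : ∀ n m, S₀ n m = Λ n m / (Real.sqrt (d n) * Real.sqrt (d m)))
    (s : Fin N → ℝ) {μ : ℝ} (hμ : 0 ≤ μ) (hn : 1 ≤ Fintype.card (Fin N)) :
    (isHermitian_rankOneDownshift hS₀ s μ).eigenvalues₀ (Fin.castLE hn 0) < 1 := by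
  have hΛ0 : ∀ n m, 0 ≤ Λ n m := fun n m => by rw [hΛ]; exact add_nonneg (hlam _) (hlam _)
  have hd : ∀ n, 0 < d n := fun n => (Finset.sum_nonneg fun m _ => hΛ0 n m).trans_lt (hdom n)
  -- the worst row ratio θ < 1
  have hN : 0 < N := by simp only [Fintype.card_fin] at hn; omega
  have hne : (Finset.univ : Finset (Fin N)).Nonempty :=
    Finset.univ_nonempty_iff.mpr (Fin.pos_iff_nonempty.mp hN)
  obtain ⟨n₀, -, hmax⟩ := Finset.exists_max_image Finset.univ (fun n => (∑ m, Λ n m) / d n) hne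
  set θ := (∑ m, Λ n₀ m) / d n₀ with hθ
  have hθ1 : θ < 1 := (div_lt_one (hd n₀)).mpr (hdom n₀)
  have hrowΛ : ∀ n, ∑ m, Λ n m ≤ θ * d n := fun n => by
    have := hmax n (Finset.mem_univ n)
    rwa [div_le_iff₀ (hd n)] at this
  refine lt_of_le_of_lt ?_ hθ1
  refine eigenvalues₀_max_rankOneDownshift_le_of_weightedRowSum_le hS₀
    (fun n m => by rw [hS]; exact div_nonneg (hΛ0 n m) (by positivity))
    (p := fun n => Real.sqrt (d n)) (fun n => Real.sqrt_pos.mpr (hd n)) ?_ s hμ hn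
  intro n
  have hsq : ∀ m, Real.sqrt (d m) ≠ 0 := fun m => (Real.sqrt_pos.mpr (hd m)).ne'
  have e : ∑ m, S₀ n m * Real.sqrt (d m) = (∑ m, Λ n m) / Real.sqrt (d n) := by
    rw [Finset.sum_div]
    exact Finset.sum_congr rfl fun m _ => by
      rw [hS, div_mul_eq_mul_div, mul_div_mul_right _ _ (hsq m)]
  rw [e, div_le_iff₀ (Real.sqrt_pos.mpr (hd n))]
  calc ∑ m, Λ n m ≤ θ * d n := hrowΛ n
    _ = θ * Real.sqrt (d n) * Real.sqrt (d n) := by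
        rw [mul_assoc, Real.mul_self_sqrt (hd n).le]

/-- The three facts about the couplings at a temperature with `12T² > A` that the assembly consumes:
`λ ≥ 0`, a uniform tail bound `τ = A/(24T²)`, and `2τ < 1`. [cite: AllenDynes1975, Eqs. (9)–(12)] -/
private theorem couplings_tail (s : Finset κ) (l ω : κ → ℝ) (hl : ∀ i ∈ s, 0 ≤ l i)
    {T : ℝ} (hT : 0 < T) (hA : ∑ i ∈ s, l i * ω i ^ 2 < 12 * T ^ 2)
    (lam : ℕ → ℝ) (hlam : ∀ k : ℕ, lam k = ∑ i ∈ s, l i * (ω i ^ 2 / (ω i ^ 2 + (2 * π * T * k) ^ 2))) :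
    (∀ k, 0 ≤ lam k) ∧ ∃ τ : ℝ, (∀ M, ∑ k ∈ Finset.range M, lam (k + 1) ≤ τ) ∧ 2 * τ < 1 := by
  refine ⟨fun k => by rw [hlam]; exact matsubaraCouplingDiscrete_nonneg s ω hl T k,
    (∑ i ∈ s, l i * ω i ^ 2) / (24 * T ^ 2), fun M => ?_, ?_⟩
  · refine le_of_eq_of_le (Finset.sum_congr rfl fun k _ => ?_) (sum_matsubaraCoupling_succ_le s ω hl hT M)
    rw [hlam]
  · rw [← lt_div_iff₀' (by norm_num : (0:ℝ) < 2), div_lt_iff₀ (by positivity)]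
    linarith

/-- **The ceiling at one temperature (full-line `Z` convention).** For a discrete Eliashberg function
`(λ_i ≥ 0, ω_i)`, a temperature with `12T² > A = Σ_i λ_i ω_i²`, any cutoff `N`, any `μ ≥ 0`, and
weights `d_n ≥ 2n+1 + λ(0) + 2Σ_{k=1}^{n} λ(k)`, the top eigenvalue of the symmetrised linearised
isotropic Eliashberg kernel is `< 1`: no superconducting solution at `T`.
[cite: AllenDynes1975, Eqs. (9)–(12)] -/
theorem eliashbergTopEigenvalue_lt_one (s : Finset κ) (l ω : κ → ℝ) (hl : ∀ i ∈ s, 0 ≤ l i)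
    {T : ℝ} (hT : 0 < T) (hA : ∑ i ∈ s, l i * ω i ^ 2 < 12 * T ^ 2)
    (lam : ℕ → ℝ) (hlam : ∀ k : ℕ, lam k = ∑ i ∈ s, l i * (ω i ^ 2 / (ω i ^ 2 + (2 * π * T * k) ^ 2)))
    (Λ : Matrix (Fin N) (Fin N) ℝ)
    (hΛ : ∀ n m : Fin N, Λ n m = lam (Nat.dist n m) + lam ((n : ℕ) + m + 1))
    (d : Fin N → ℝ)
    (hd : ∀ n : Fin N, (2 * ((n : ℕ) : ℝ) + 1) + lam 0 + 2 * ∑ k ∈ Finset.range n, lam (k + 1) ≤ d n)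
    (S₀ : Matrix (Fin N) (Fin N) ℝ) (hS₀ : S₀.IsHermitian)
    (hS : ∀ n m, S₀ n m = Λ n m / (Real.sqrt (d n) * Real.sqrt (d m)))
    (sv : Fin N → ℝ) {μ : ℝ} (hμ : 0 ≤ μ) (hn : 1 ≤ Fintype.card (Fin N)) :
    (isHermitian_rankOneDownshift hS₀ sv μ).eigenvalues₀ (Fin.castLE hn 0) < 1 := by
  obtain ⟨hlam0, τ, hτ, h2τ⟩ := couplings_tail s l ω hl hT hA lam hlam
  refine eigenvalues₀_max_lt_one_of_rowDominance lam hlam0 Λ hΛ d ?_ S₀ hS₀ hS sv hμ hn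
  intro n
  rw [Finset.sum_congr rfl fun m _ => hΛ n m,
    Fin.sum_univ_eq_sum_range (fun m => lam (Nat.dist n m) + lam ((n : ℕ) + m + 1)) N]
  exact sum_phononRow_lt_weight hlam0 hτ h2τ n N (hd n)

/-- **The ceiling at one temperature (truncated `Z` convention)**: as `eliashbergTopEigenvalue_lt_one`
but for solvers whose mass-renormalisation sum runs over the same `N` frequencies,
`d_n ≥ 2n+1 + Σ_{m<N} λ(|n−m|) − Σ_{m<N} λ(n+m+1)`. [cite: AllenDynes1975, Eqs. (9)–(12)] -/
theorem eliashbergTopEigenvalue_lt_one_trunc (s : Finset κ) (l ω : κ → ℝ) (hl : ∀ i ∈ s, 0 ≤ l i)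
    {T : ℝ} (hT : 0 < T) (hA : ∑ i ∈ s, l i * ω i ^ 2 < 12 * T ^ 2)
    (lam : ℕ → ℝ) (hlam : ∀ k : ℕ, lam k = ∑ i ∈ s, l i * (ω i ^ 2 / (ω i ^ 2 + (2 * π * T * k) ^ 2)))
    (Λ : Matrix (Fin N) (Fin N) ℝ)
    (hΛ : ∀ n m : Fin N, Λ n m = lam (Nat.dist n m) + lam ((n : ℕ) + m + 1))
    (d : Fin N → ℝ)
    (hd : ∀ n : Fin N, (2 * ((n : ℕ) : ℝ) + 1) + ∑ m ∈ Finset.range N, lam (Nat.dist n m)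
      - ∑ m ∈ Finset.range N, lam ((n : ℕ) + m + 1) ≤ d n)
    (S₀ : Matrix (Fin N) (Fin N) ℝ) (hS₀ : S₀.IsHermitian)
    (hS : ∀ n m, S₀ n m = Λ n m / (Real.sqrt (d n) * Real.sqrt (d m)))
    (sv : Fin N → ℝ) {μ : ℝ} (hμ : 0 ≤ μ) (hn : 1 ≤ Fintype.card (Fin N)) :
    (isHermitian_rankOneDownshift hS₀ sv μ).eigenvalues₀ (Fin.castLE hn 0) < 1 := by
  obtain ⟨hlam0, τ, hτ, h2τ⟩ := couplings_tail s l ω hl hT hA lam hlam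
  refine eigenvalues₀_max_lt_one_of_rowDominance lam hlam0 Λ hΛ d ?_ S₀ hS₀ hS sv hμ hn
  intro n
  rw [Finset.sum_congr rfl fun m _ => hΛ n m,
    Fin.sum_univ_eq_sum_range (fun m => lam (Nat.dist n m) + lam ((n : ℕ) + m + 1)) N]
  exact sum_phononRow_lt_weight_trunc hlam0 hτ h2τ n N (hd n)

end Assembly

/-! ### Threshold form: `BddAbove` and `T_c ≤ (A/12)^{1/2}` -/

section Threshold

/-- **Threshold form.** If a solver's criticality indicator satisfies `ρ(T) < 1` for every `T > T*`
(`T* ≥ 0`), then the super-level set `{T > 0 | 1 ≤ ρ(T)}` is bounded above by `T*` and its supremum —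
the linearised-equation `T_c` (`sSup ∅ = 0` when there is no superconductivity) — is `≤ T*`. This is
the `BddAbove` premise of the `sSup`-form corner rules, discharged. [cite: AllenDynes1975, §III] -/
theorem sSup_superlevel_le_of_lt_one {ρ : ℝ → ℝ} {Tstar : ℝ} (h0 : 0 ≤ Tstar)
    (h : ∀ T, Tstar < T → ρ T < 1) :
    BddAbove {T : ℝ | 0 < T ∧ 1 ≤ ρ T} ∧ sSup {T : ℝ | 0 < T ∧ 1 ≤ ρ T} ≤ Tstar := by
  have hub : ∀ T ∈ {T : ℝ | 0 < T ∧ 1 ≤ ρ T}, T ≤ Tstar := fun T hT => by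
    by_contra hlt
    exact absurd (h T (lt_of_not_ge hlt)) (not_lt.mpr hT.2)
  refine ⟨⟨Tstar, hub⟩, ?_⟩
  by_cases hne : ({T : ℝ | 0 < T ∧ 1 ≤ ρ T} : Set ℝ).Nonempty
  · exact csSup_le hne hub
  · rw [Set.not_nonempty_iff_eq_empty] at hne
    rw [hne, Real.sSup_empty]
    exact h0

/-- **`T_c ≤ (λ⟨ω²⟩/12)^{1/2}` for the linearised isotropic Migdal–Eliashberg equations.** Let
`ρ : ℝ → ℝ` be any criticality indicator which, at every temperature `T > (A/12)^{1/2}`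
(`A = Σ_i λ_i ω_i²`), equals the top eigenvalue of SOME symmetrised kernel `S₀ − 2μ ssᵀ` as in
`eliashbergTopEigenvalue_lt_one` (any cutoff `N(T) ≥ 1`, any `μ(T) ≥ 0`, full-line weights) — this is
how every imaginary-axis solver in use defines `T < T_c`. Then `{T > 0 | 1 ≤ ρ T}` is bounded above
and `T_c = sSup {T > 0 | 1 ≤ ρ T} ≤ (A/12)^{1/2}`; i.e. `k_B T_c ≤ 0.2887 ħ (λ⟨ω²⟩)^{1/2}`, to be
compared with the Allen–Dynes large-`λ` asymptote `0.1827 (λ⟨ω²⟩)^{1/2}`.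
[cite: AllenDynes1975, Eqs. (9)–(12) and (26)] [cite: KiesslingAltshulerYuzbashyan2025II, Thm. 6] -/
theorem eliashbergTc_le_sqrt {κ : Type*} (s : Finset κ) (l ω : κ → ℝ) (hl : ∀ i ∈ s, 0 ≤ l i)
    (ρ : ℝ → ℝ)
    (hρ : ∀ T : ℝ, Real.sqrt ((∑ i ∈ s, l i * ω i ^ 2) / 12) < T →
      ∃ (N : ℕ) (hn : 1 ≤ Fintype.card (Fin N)) (lam : ℕ → ℝ) (Λ : Matrix (Fin N) (Fin N) ℝ)
        (d : Fin N → ℝ) (S₀ : Matrix (Fin N) (Fin N) ℝ) (hS₀ : S₀.IsHermitian) (sv : Fin N → ℝ) (μ : ℝ),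
        (∀ k : ℕ, lam k = ∑ i ∈ s, l i * (ω i ^ 2 / (ω i ^ 2 + (2 * π * T * k) ^ 2))) ∧
        (∀ n m : Fin N, Λ n m = lam (Nat.dist n m) + lam ((n : ℕ) + m + 1)) ∧
        (∀ n : Fin N, (2 * ((n : ℕ) : ℝ) + 1) + lam 0 + 2 * ∑ k ∈ Finset.range n, lam (k + 1) ≤ d n) ∧
        (∀ n m, S₀ n m = Λ n m / (Real.sqrt (d n) * Real.sqrt (d m))) ∧ 0 ≤ μ ∧
        ρ T = (isHermitian_rankOneDownshift hS₀ sv μ).eigenvalues₀ (Fin.castLE hn 0)) :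
    BddAbove {T : ℝ | 0 < T ∧ 1 ≤ ρ T} ∧
      sSup {T : ℝ | 0 < T ∧ 1 ≤ ρ T} ≤ Real.sqrt ((∑ i ∈ s, l i * ω i ^ 2) / 12) := by
  refine sSup_superlevel_le_of_lt_one (Real.sqrt_nonneg _) fun T hT => ?_
  have hTpos : 0 < T := lt_of_le_of_lt (Real.sqrt_nonneg _) hT
  obtain ⟨N, hn, lam, Λ, d, S₀, hS₀, sv, μ, hlam, hΛ, hd, hS, hμ, hρT⟩ := hρ T hT
  rw [hρT]
  have hA : ∑ i ∈ s, l i * ω i ^ 2 < 12 * T ^ 2 := by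
    have := (Real.sqrt_lt' hTpos).mp hT
    linarith
  exact eliashbergTopEigenvalue_lt_one s l ω hl hTpos hA lam hlam Λ hΛ d hd S₀ hS₀ hS sv hμ hn

end Threshold

end Literature.MathematicalPhysics.QuantumManyBody
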